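import Mathlib
import HarnessLib
/-!
# The argmax calculus behind the gauges (G1)/(G2): a nondegenerate critical point persists and moves differentiably
# (zone Z1 TEMPLATE §T1.3, kernel)

HONEST FRAMING (cell ns-blowup GROUP B «PROFILE SEARCH», zone Z1; D-0035/D-0074): part XVII of the Z1 dictionary. TEMPLATE
(G1)/(G1b)/(G2b) derive the second gauge function `ζ(τ)` by differentiating the constraint `∇Φ(y_m(τ), τ) = 0` along the
curve of maxima `τ ↦ y_m(τ)` of `Φ = ½|V|²` (resp. of `U₁`): «`ζ(τ) = e_zᵀ H(y_m)⁻¹ ∇(V·N[V])(y_m)`, `H := ∇²Φ(y_m)` …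
(negative definite for a non-degenerate max)», and every decl table so far lists «the argmax calculus proper behind
(G1)/(G2) — existence and differentiability of the maximum curve — PAPER» ((K14), (K17), (K20), (K33)). This file makes the
generic part kernel, as a reading of Mathlib's curried bivariate implicit function theorem
(`implicitFunctionOfBivariate`, `hasStrictFDerivAt_implicitFunctionOfBivariate`) on the equation `D_yΦ(τ, y) = 0`:

* `criticalCurve_exists` — **a nondegenerate critical point persists, uniquely and differentiably**: if the
  `y`-gradient `g(τ, y) := D_yΦ(τ, ·)(y)` has partial derivatives `g_τ`, `g_y` (the Hessian) near `(τ₀, y₀)`, continuous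
  at `(τ₀, y₀)`, with `g(τ₀, y₀) = 0` and `g_y(τ₀, y₀)` invertible, then there is `y_m : ℝ → E` with `y_m(τ₀) = y₀`,
  `g(τ, y_m(τ)) = 0` for `τ` near `τ₀`, near `(τ₀, y₀)` the critical points of `Φ(τ, ·)` are EXACTLY the points `y_m(τ)`,
  and `y_m` is strictly differentiable at `τ₀` with derivative `−g_y(τ₀, y₀)⁻¹ ∘ g_τ(τ₀, y₀)` — the formula
  «`ẏ_m = −H⁻¹ ∂_τ∇Φ`» from which (G1b)/(G2b) read `ζ`;
* `criticalCurve_hasDerivAt` — the same as a derivative of a curve `ℝ → E`: `ẏ_m(τ₀) = −H⁻¹ (∂_τ∇Φ)(τ₀, y₀)`.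

What stays PAPER: that the persisting critical point is the (global) MAXIMUM of `|V(·, τ)|²` (a negative definite Hessian
is invertible, and strictness of the local maximum persists by continuity — not typed), the jump case (G1c), and the
identification of `∂_τ∇Φ` through the PDE (the (Z1-E) values — part IX `modulation_eq_inner_of_critical` is the algebraic
core at one instant). **Nothing here refers to a Navier–Stokes solution.** «violates: n/a — dictionary»; bears_on LADDER-NS
N5/Z1 → N1 linear core / N0⁻ ((G1)/(G2)). Author: ns-blowup-profile-eng-1 g7, 2026-08-27.
-/

open Filter Topology Set Function

namespace Summit.NavierStokesRegularity.OSWSelfSimilar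
namespace TypeIIModulationDictionary

section Argmax

variable {E : Type*} [NormedAddCommGroup E] [NormedSpace ℝ E] [CompleteSpace E]

/-- **A nondegenerate critical point persists, uniquely and differentiably** (the argmax calculus behind TEMPLATE
(G1)/(G1b)/(G2b), generic part; Mathlib's curried bivariate implicit function theorem read on `D_yΦ = 0`). Let
`g : ℝ → E → (E →L[ℝ] ℝ)` (in the application `g τ y = D(Φ τ)(y)`, the `y`-gradient of `Φ(τ, ·) = ½|V(·, τ)|²`) have
partial derivatives `g₁` (in `τ`) and `g₂` (in `y`: the Hessian) near `(τ₀, y₀)`, both continuous at `(τ₀, y₀)`, with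
`g τ₀ y₀ = 0` (critical point) and `g₂ τ₀ y₀` invertible (nondegenerate). Then there is a curve `y_m : ℝ → E` with
`y_m τ₀ = y₀`, `g τ (y_m τ) = 0` for all `τ` near `τ₀`, such that near `(τ₀, y₀)` the solutions of `g τ y = 0` are
exactly the points `(τ, y_m τ)`, and `y_m` is strictly differentiable at `τ₀` with derivative
`−(g₂ τ₀ y₀)⁻¹ ∘ g₁ τ₀ y₀` («`ẏ_m = −H⁻¹ ∂_τ∇Φ`»). [new here — dictionary] -/
theorem criticalCurve_exists {g : ℝ → E → (E →L[ℝ] ℝ)} {g₁ : ℝ → E → (ℝ →L[ℝ] (E →L[ℝ] ℝ))}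
    {g₂ : ℝ → E → (E →L[ℝ] (E →L[ℝ] ℝ))} {τ₀ : ℝ} {y₀ : E}
    (dg₁ : ∀ᶠ v in 𝓝 (τ₀, y₀), HasFDerivAt (g · v.2) (g₁ v.1 v.2) v.1)
    (dg₂ : ∀ᶠ v in 𝓝 (τ₀, y₀), HasFDerivAt (g v.1 ·) (g₂ v.1 v.2) v.2)
    (cg₁ : ContinuousAt ↿g₁ (τ₀, y₀)) (cg₂ : ContinuousAt ↿g₂ (τ₀, y₀))
    (hcrit : g τ₀ y₀ = 0) (hH : (g₂ τ₀ y₀).IsInvertible) :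
    ∃ ym : ℝ → E, ym τ₀ = y₀ ∧ (∀ᶠ τ in 𝓝 τ₀, g τ (ym τ) = 0) ∧
      (∀ᶠ v in 𝓝 (τ₀, y₀), g v.1 v.2 = 0 ↔ ym v.1 = v.2) ∧
      HasStrictFDerivAt ym (-(g₂ τ₀ y₀).inverse ∘L g₁ τ₀ y₀) τ₀ := by
  have dg₁' : ∀ᶠ v in 𝓝 ((τ₀, y₀) : ℝ × E), HasFDerivAt (g · v.2) (g₁ v.1 v.2) v.1 := dg₁
  have dg₂' : ∀ᶠ v in 𝓝 ((τ₀, y₀) : ℝ × E), HasFDerivAt (g v.1 ·) (g₂ v.1 v.2) v.2 := dg₂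
  have cg₁' : ContinuousAt ↿g₁ ((τ₀, y₀) : ℝ × E) := cg₁
  have cg₂' : ContinuousAt ↿g₂ ((τ₀, y₀) : ℝ × E) := cg₂
  have hH' : (g₂ ((τ₀, y₀) : ℝ × E).1 ((τ₀, y₀) : ℝ × E).2).IsInvertible := hH
  refine ⟨implicitFunctionOfBivariate dg₁' dg₂' cg₁' cg₂' hH', ?_, ?_, ?_, ?_⟩
  · have h := (eventually_apply_eq_iff_implicitFunctionOfBivariate dg₁' dg₂' cg₁' cg₂' hH').self_of_nhds
    exact h.1 rfl
  · have h := eventually_apply_implicitFunctionOfBivariate dg₁' dg₂' cg₁' cg₂' hH'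
    filter_upwards [h] with τ hτ
    rw [hτ]
    exact hcrit
  · have h := eventually_apply_eq_iff_implicitFunctionOfBivariate dg₁' dg₂' cg₁' cg₂' hH'
    filter_upwards [h] with v hv
    rw [← hv, hcrit]
  · exact hasStrictFDerivAt_implicitFunctionOfBivariate dg₁' dg₂' cg₁' cg₂' hH'

/-- **The velocity of the critical point**, as a derivative of the curve `τ ↦ y_m(τ)`: under the hypotheses of
`criticalCurve_exists`, the curve it provides has `HasDerivAt y_m (−(g₂ τ₀ y₀)⁻¹ (g₁ τ₀ y₀ 1)) τ₀` — TEMPLATE (G1b)'s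
`ẏ_m = −H⁻¹ ∂_τ∇Φ(y_m, τ)`, whose `z`-component gives `ζ`. [new here — dictionary] -/
theorem criticalCurve_hasDerivAt {g : ℝ → E → (E →L[ℝ] ℝ)} {g₁ : ℝ → E → (ℝ →L[ℝ] (E →L[ℝ] ℝ))}
    {g₂ : ℝ → E → (E →L[ℝ] (E →L[ℝ] ℝ))} {τ₀ : ℝ} {y₀ : E}
    (dg₁ : ∀ᶠ v in 𝓝 (τ₀, y₀), HasFDerivAt (g · v.2) (g₁ v.1 v.2) v.1)
    (dg₂ : ∀ᶠ v in 𝓝 (τ₀, y₀), HasFDerivAt (g v.1 ·) (g₂ v.1 v.2) v.2)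
    (cg₁ : ContinuousAt ↿g₁ (τ₀, y₀)) (cg₂ : ContinuousAt ↿g₂ (τ₀, y₀))
    (hcrit : g τ₀ y₀ = 0) (hH : (g₂ τ₀ y₀).IsInvertible) :
    ∃ ym : ℝ → E, ym τ₀ = y₀ ∧ (∀ᶠ τ in 𝓝 τ₀, g τ (ym τ) = 0) ∧
      HasDerivAt ym (-((g₂ τ₀ y₀).inverse (g₁ τ₀ y₀ 1))) τ₀ := by
  obtain ⟨ym, h0, heq, -, hd⟩ := criticalCurve_exists dg₁ dg₂ cg₁ cg₂ hcrit hH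
  refine ⟨ym, h0, heq, ?_⟩
  have h := hd.hasFDerivAt.hasDerivAt
  convert h using 1
  simp [ContinuousLinearMap.comp_apply]

end Argmax

end TypeIIModulationDictionary
end Summit.NavierStokesRegularity.OSWSelfSimilar
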